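import Mathlib
import Literature.Computability.AlgebraicComplexity.GKKP11Thm4Proofs
import HarnessLib

/-!
# ValiantsHypothesis / SymPencil — crux `SymmetrizePermPairs` (stmt-ValiantsHypothesis-17793),
# stub `stub_induce`, step (C3b): the symmetric affine pencil of an edge-weighted DAG

Helper layer for the OPEN stub `stub_induce` of the line
`Cruxes/SdcThesis/Lines/birth_SymmetrizePermPairs.lean` (merged-desk RULING #195, task (C3) of
the memo `NOTE-p7g11-17793-C3-equivariantGKKP-sizing.md`, in the ABP/DAG model announced on the
val-lit bus 2026-08-28T04:06Z).  An *edge-weighted DAG* on a finite vertex type `V` is a square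
matrix `E : Matrix V V R` graded by `b : V → ℕ` (`E u v ≠ 0 → b u < b v`); its *value* from the
weights `a : V → R` out of an external source to a sink `t` is `a ⬝ᵥ y` for the (unique) solution
of the path recursion `y = E *ᵥ y + δ_t`.  The Grenet–Kaltofen–Koiran–Portier layout
(`GKKP2011.Thm4.det_layout`, tree) then says that the SYMMETRIC block matrix
`[[0, (a, δ_t)], [(a, δ_t)ᵀ, [[0, (1 - E)ᵀ], [1 - E, 0]]]]` on `Unit ⊕ (V ⊕ V)` has determinant
`(-1)^{|V|+1} · 2 · (a ⬝ᵥ y)`: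

* `grade_add_le_of_pow_apply_ne_zero`, `pow_eq_zero_of_graded`, `one_sub_mul_pathMatrix`,
  `det_one_sub_eq_one` — the weight matrix of a graded DAG is nilpotent, `1 - E` is unipotent;
* `det_dagPencil` — the determinant identity above;
* `dagPencil_isSymm` — the pencil is symmetric;
* `dagPencil_totalDegree_le` — over `R = MvPolynomial σ k`, affine weights give affine entries;
* `dagPencil_map_eq_submatrix` — covariance: a ring endomorphism `φ` transporting the weights
  along a DAG automorphism `θ` fixing `t` acts on the pencil as the simultaneous row/column
  permutation `Sum.map id (Sum.map θ θ)`.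

No new definitions (the pencil is written inline), no named facts.  Honest framing: helper layer
for an OPEN stub of an OPEN crux; `VP ≠ VNP` is NOT proved and nothing here is progress on it
beyond this bookkeeping.
-/

-- `Summit.ValiantsHypothesis.ValiantsHypothesis.…` is the tree's mandated single-conjunct layout
-- (Sub = Summit), so the duplicated namespace component is intended.
set_option linter.dupNamespace false

namespace Summit.ValiantsHypothesis.ValiantsHypothesis.Theorems.SymPencilSymmetrizePermPairs.Dag

open Matrix

variable {V : Type*} [DecidableEq V] {R : Type*} [CommRing R]

/-! ### Graded weight matrices are nilpotent -/

/-- Powers of the weight matrix of a graded DAG climb the grading: a nonzero entry of `E ^ k` at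
`(u, v)` forces `b u + k ≤ b v`. [folklore] -/
theorem grade_add_le_of_pow_apply_ne_zero [Fintype V] (E : Matrix V V R) (b : V → ℕ)
    (hE : ∀ u v, E u v ≠ 0 → b u < b v) :
    ∀ (k : ℕ) (u v : V), (E ^ k) u v ≠ 0 → b u + k ≤ b v := by
  intro k
  induction k with
  | zero =>
    intro u v h
    rw [pow_zero] at h
    by_cases huv : u = v
    · subst huv; simp
    · exact absurd (Matrix.one_apply_ne huv) h
  | succ k ih =>
    intro u v h
    rw [pow_succ, Matrix.mul_apply] at h
    obtain ⟨w, -, hw⟩ := Finset.exists_ne_zero_of_sum_ne_zero h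
    have h1 := ih u w (left_ne_zero_of_mul hw)
    have h2 := hE w v (right_ne_zero_of_mul hw)
    omega

/-- The weight matrix of a graded DAG is nilpotent: `E ^ (sup b + 1) = 0`. [folklore] -/
theorem pow_eq_zero_of_graded [Fintype V] (E : Matrix V V R) (b : V → ℕ)
    (hE : ∀ u v, E u v ≠ 0 → b u < b v) : E ^ (Finset.univ.sup b + 1) = 0 := by
  ext u v
  by_contra h
  have h1 := grade_add_le_of_pow_apply_ne_zero E b hE _ u v h
  have h2 : b v ≤ Finset.univ.sup b := Finset.le_sup (Finset.mem_univ v)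
  omega

/-- The *path matrix* `G = Σ_{k ≤ sup b} E ^ k` of a graded DAG inverts `1 - E`:
`(1 - E) * G = 1`. [folklore] -/
theorem one_sub_mul_pathMatrix [Fintype V] (E : Matrix V V R) (b : V → ℕ)
    (hE : ∀ u v, E u v ≠ 0 → b u < b v) :
    (1 - E) * ∑ k ∈ Finset.range (Finset.univ.sup b + 1), E ^ k = 1 := by
  rw [mul_neg_geom_sum, pow_eq_zero_of_graded E b hE, sub_zero]

/-- … and on the other side: `G * (1 - E) = 1`. [folklore] -/
theorem pathMatrix_mul_one_sub [Fintype V] (E : Matrix V V R) (b : V → ℕ)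
    (hE : ∀ u v, E u v ≠ 0 → b u < b v) :
    (∑ k ∈ Finset.range (Finset.univ.sup b + 1), E ^ k) * (1 - E) = 1 := by
  rw [geom_sum_mul_neg, pow_eq_zero_of_graded E b hE, sub_zero]

/-- `1 - E` is unipotent for a graded DAG: `det (1 - E) = 1` (block-triangular with identity
diagonal blocks along the grading). [folklore] -/
theorem det_one_sub_eq_one [Fintype V] (E : Matrix V V R) (b : V → ℕ)
    (hE : ∀ u v, E u v ≠ 0 → b u < b v) : (1 - E).det = 1 := by
  have hBT : (1 - E).BlockTriangular b := by
    intro i j hij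
    have hne : i ≠ j := by
      rintro rfl
      exact lt_irrefl _ hij
    have hE0 : E i j = 0 := by
      by_contra h
      have := hE i j h
      omega
    simp [Matrix.one_apply_ne hne, hE0]
  rw [hBT.det]
  refine Finset.prod_eq_one fun a _ => ?_
  have hblk : (1 - E).toSquareBlock b a = 1 := by
    ext ⟨i, hi⟩ ⟨j, hj⟩
    have hE0 : E i j = 0 := by
      by_contra h
      have := hE i j h
      omega
    by_cases hij : i = j
    · subst hij
      simp [Matrix.toSquareBlock_def, hE0]
    · have hij' : (⟨i, hi⟩ : {v // b v = a}) ≠ ⟨j, hj⟩ := fun h => hij (congrArg Subtype.val h)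
      simp [Matrix.toSquareBlock_def, hE0, Matrix.one_apply_ne hij, Matrix.one_apply_ne hij']
  rw [hblk, det_one]

/-! ### The symmetric pencil of a DAG and its determinant -/

/-- The path recursion determines the value vector: if `y = E *ᵥ y + δ_t` then `y = G *ᵥ δ_t` for
the path matrix `G`. [folklore] -/
theorem eq_pathMatrix_mulVec [Fintype V] (E : Matrix V V R) (b : V → ℕ)
    (hE : ∀ u v, E u v ≠ 0 → b u < b v) (t : V) (y : V → R)
    (hy : y = E *ᵥ y + Pi.single t 1) :
    y = (∑ k ∈ Finset.range (Finset.univ.sup b + 1), E ^ k) *ᵥ Pi.single t 1 := by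
  have h1 : (1 - E) *ᵥ y = Pi.single t 1 := by
    rw [Matrix.sub_mulVec, Matrix.one_mulVec]
    exact sub_eq_of_eq_add' hy
  rw [← h1, Matrix.mulVec_mulVec, pathMatrix_mul_one_sub E b hE, Matrix.one_mulVec]

/-- **The symmetric pencil of an edge-weighted DAG (Grenet–Kaltofen–Koiran–Portier layout).**
For a graded weight matrix `E`, source weights `a`, a sink `t` and the solution `y` of the path
recursion `y = E *ᵥ y + δ_t`, the symmetric block matrix
`[[0, (a, δ_t)], [(a, δ_t)ᵀ, [[0, (1 - E)ᵀ], [1 - E, 0]]]]` has determinant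
`(-1)^{|V|+1} · 2 · (a ⬝ᵥ y)` — twice the signed value of the DAG.  One application of the tree's
`GKKP2011.Thm4.det_layout` with `X = 1 - E`, `G` the path matrix. [cite: GrenetEtAl2011, Thm 4] -/
theorem det_dagPencil [Fintype V] (E : Matrix V V R) (b : V → ℕ) (hE : ∀ u v, E u v ≠ 0 → b u < b v)
    (a : V → R) (t : V) (y : V → R) (hy : y = E *ᵥ y + Pi.single t 1) :
    (Matrix.fromBlocks (0 : Matrix Unit Unit R) (Matrix.of fun _ => Sum.elim a (Pi.single t 1))
      (Matrix.of fun uv (_ : Unit) => Sum.elim a (Pi.single t 1) uv)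
      (Matrix.fromBlocks 0 (1 - E)ᵀ (1 - E) 0)).det =
      (-1) ^ (Fintype.card V + 1) * (2 * (a ⬝ᵥ y)) := by
  have hdet : (1 - E).det ^ 2 = 1 := by rw [det_one_sub_eq_one E b hE, one_pow]
  rw [Literature.Computability.AlgebraicComplexity.GKKP2011.Thm4.det_layout (1 - E) _ (one_sub_mul_pathMatrix E b hE) hdet a (Pi.single t 1),
    ← Matrix.dotProduct_mulVec, ← eq_pathMatrix_mulVec E b hE t y hy]

/-- The DAG pencil is a symmetric matrix. [folklore] -/
theorem dagPencil_isSymm (E : Matrix V V R) (a : V → R) (t : V) :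
    (Matrix.fromBlocks (0 : Matrix Unit Unit R) (Matrix.of fun _ => Sum.elim a (Pi.single t 1))
      (Matrix.of fun uv (_ : Unit) => Sum.elim a (Pi.single t 1) uv)
      (Matrix.fromBlocks 0 (1 - E)ᵀ (1 - E) 0)).IsSymm := by
  unfold Matrix.IsSymm
  rw [Matrix.fromBlocks_transpose, Matrix.fromBlocks_transpose]
  simp only [Matrix.transpose_zero, Matrix.transpose_transpose]
  congr 1

/-! ### Affine weights give affine entries -/

section Affine

variable {σ k : Type*} [CommRing k]

/-- Over a polynomial ring, if the weights `E u v` and `a v` are affine (total degree `≤ 1`) then so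
is every entry of the DAG pencil. [folklore] -/
theorem dagPencil_totalDegree_le (E : Matrix V V (MvPolynomial σ k)) (a : V → MvPolynomial σ k)
    (t : V) (hE : ∀ u v, (E u v).totalDegree ≤ 1) (ha : ∀ v, (a v).totalDegree ≤ 1) :
    ∀ i j, ((Matrix.fromBlocks (0 : Matrix Unit Unit (MvPolynomial σ k))
      (Matrix.of fun _ => Sum.elim a (Pi.single t 1))
      (Matrix.of fun uv (_ : Unit) => Sum.elim a (Pi.single t 1) uv)
      (Matrix.fromBlocks 0 (1 - E)ᵀ (1 - E) 0)) i j).totalDegree ≤ 1 := by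
  have hδ : ∀ v : V, ((Pi.single t 1 : V → MvPolynomial σ k) v).totalDegree ≤ 1 := by
    intro v
    by_cases hv : v = t
    · subst hv; simp
    · simp [Pi.single_eq_of_ne hv]
  have h1E : ∀ u v w z : V,
      ((1 : Matrix V V (MvPolynomial σ k)) u v - E w z).totalDegree ≤ 1 := by
    intro u v w z
    refine (MvPolynomial.totalDegree_sub _ _).trans (max_le ?_ (hE w z))
    by_cases huv : u = v
    · subst huv; simp
    · simp [Matrix.one_apply_ne huv]
  rintro (i | (i | i)) (j | (j | j)) <;> simp [Matrix.fromBlocks, ha, hδ, h1E]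

end Affine

/-! ### Covariance under DAG automorphisms -/

/-- **Covariance.**  If a ring endomorphism `φ` transports the weights along a vertex permutation
`θ` fixing the sink (`φ (E u v) = E (θ u) (θ v)`, `φ (a v) = a (θ v)`, `θ t = t`), then applying
`φ` entrywise to the DAG pencil is the simultaneous row/column permutation by
`Sum.map id (Sum.map θ θ)`. [folklore] -/
theorem dagPencil_map_eq_submatrix (E : Matrix V V R) (a : V → R) (t : V) (φ : R →+* R)
    (θ : Equiv.Perm V) (hθt : θ t = t) (hE : ∀ u v, φ (E u v) = E (θ u) (θ v))
    (ha : ∀ v, φ (a v) = a (θ v)) :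
    (Matrix.fromBlocks (0 : Matrix Unit Unit R) (Matrix.of fun _ => Sum.elim a (Pi.single t 1))
      (Matrix.of fun uv (_ : Unit) => Sum.elim a (Pi.single t 1) uv)
      (Matrix.fromBlocks 0 (1 - E)ᵀ (1 - E) 0)).map φ =
    (Matrix.fromBlocks (0 : Matrix Unit Unit R) (Matrix.of fun _ => Sum.elim a (Pi.single t 1))
      (Matrix.of fun uv (_ : Unit) => Sum.elim a (Pi.single t 1) uv)
      (Matrix.fromBlocks 0 (1 - E)ᵀ (1 - E) 0)).submatrix (Sum.map id (Sum.map θ θ))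
        (Sum.map id (Sum.map θ θ)) := by
  have hδ : ∀ v : V, φ ((Pi.single t 1 : V → R) v) = (Pi.single t 1 : V → R) (θ v) := by
    intro v
    by_cases hv : v = t
    · subst hv; simp [hθt]
    · have hv' : θ v ≠ t := fun h => hv (θ.injective (h.trans hθt.symm))
      simp [Pi.single_eq_of_ne hv, Pi.single_eq_of_ne hv']
  have h1 : ∀ u v : V, φ ((1 : Matrix V V R) u v) = (1 : Matrix V V R) (θ u) (θ v) := by
    intro u v
    by_cases huv : u = v
    · subst huv; simp
    · have huv' : θ u ≠ θ v := fun h => huv (θ.injective h)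
      simp [Matrix.one_apply_ne huv, Matrix.one_apply_ne huv']
  ext (i | (i | i)) (j | (j | j)) <;> simp [Matrix.fromBlocks, ha, hδ, hE, h1, map_sub]

end Summit.ValiantsHypothesis.ValiantsHypothesis.Theorems.SymPencilSymmetrizePermPairs.Dag
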